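import Summits.KontsevichZagierPeriods.KontsevichZagierPeriods.Theorems.SoloBlindFermatCubic
import Summits.KontsevichZagierPeriods.KontsevichZagierPeriods.Theorems.SoloBlindDuplication
import HarnessLib

/-!
# Two more rational planar regions: the Fermat quartic and the elliptic curve `y² = 1 - x³`

Two `ℚ`-RATIONAL two-dimensional integral representations and their classes in
`Q = FormalRep ⧸ relations`, each by three moves (Newton–Leibniz in `y`, a power substitution,
a translation) plus Legendre's duplication formula (`SoloBlindDuplication.betaQ_dupl`):

* the Fermat quartic quadrant `R₄ = [{0<x<1, 0≤y, x⁴+y⁴ ≤ 1}, 1]` (`quart2`):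
  `[R₄] = ⅛β(¼,¼) = (⅛·duplCoeff ¼)•β(¼,½)` (`mkQ_quart2`, `mkQ_quart2'`), `duplCoeff ¼ = √2`;
  so `R₄` lies in the lemniscate sector (`SoloBlindEllipticSectors`);
* the region under the elliptic curve `y² = 1 - x³`, `R₃ = [{0<x<1, 0≤y, y² ≤ 1-x³}, 1]`
  (`ecub2`): `[R₃] = (1/5)β(⅓,½) = ((1/5)(duplCoeff ⅓)⁻¹)•β(⅓,⅓)` (`mkQ_ecub2`, `mkQ_ecub2'`),
  `duplCoeff ⅓ = 2^{1/3}`; so `R₃` lies in the equianharmonic sector.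

References: M. Kontsevich, D. Zagier, *Periods* (2001), §1.1–1.2.
-/

noncomputable section

namespace Summit.KontsevichZagierPeriods.KontsevichZagierPeriods.Theorems

open Set MeasureTheory
open Literature.ModelTheory.ExponentialFields (IsSemialgebraic)
open MvPolynomial (aeval X C)
open Literature.NumberTheory.Transcendental
open Literature.NumberTheory.Transcendental.KZ

namespace SoloBlind

section estimates

variable {x : ℝ}

/-- The exponent `5/4 - 1 = 1/4`. -/
theorem fiveQuarters_sub_one : ((((5:ℚ) / 4 : ℚ) : ℝ) - 1) = (1:ℝ) / 4 := by
  push_cast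
  norm_num

/-- The exponent `3/2 - 1 = 1/2`. -/
theorem threeHalves_sub_one : ((((3:ℚ) / 2 : ℚ) : ℝ) - 1) = (1:ℝ) / 2 := by
  push_cast
  norm_num

/-- `(w^{1/4})⁴ = w` for `w ≥ 0`. -/
theorem rpow_quarter_pow_four {w : ℝ} (hw : 0 ≤ w) :
    (w ^ ((((5:ℚ) / 4 : ℚ) : ℝ) - 1)) ^ 4 = w := by
  rw [fiveQuarters_sub_one, ← Real.rpow_natCast, ← Real.rpow_mul hw]
  norm_num

/-- `w^{3/2-1} = √w`. -/
theorem rpow_threeHalves_sub_one_eq_sqrt (w : ℝ) :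
    w ^ ((((3:ℚ) / 2 : ℚ) : ℝ) - 1) = Real.sqrt w := by
  rw [threeHalves_sub_one, Real.sqrt_eq_rpow]

end estimates

/-! ## The Fermat quartic: `(1-x⁴)^{1/4}` on the line -/

/-- The integrand `(1-x⁴)^{1/4}` of `R₄` on the line. -/
def quart (x : ℝ) : ℝ := (1 - x ^ 4) ^ ((((5:ℚ) / 4 : ℚ) : ℝ) - 1)

/-- `quart ≥ 0` on `(0,1)`. -/
theorem quart_nonneg {x : ℝ} (hx : x ∈ Ioo (0:ℝ) 1) : 0 ≤ quart x :=
  Real.rpow_nonneg (one_sub_pow_four_pos hx).le _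

/-- `quart` is continuous. -/
theorem continuous_quart : Continuous quart :=
  (by fun_prop : Continuous fun x : ℝ => 1 - x ^ 4).rpow_const fun _ =>
    Or.inr (by rw [fiveQuarters_sub_one]; norm_num)

/-- `quart` is integrable on `(0,1)`. -/
theorem integrableOn_quart : IntegrableOn quart (Ioo 0 1) :=
  (continuous_quart.continuousOn.integrableOn_Icc (μ := volume)).mono_set Ioo_subset_Icc_self

/-- `quart` is `ℚ`-semialgebraic on `(0,1)`. -/
theorem isSemialgebraicFunOn_quart :
    IsSemialgebraicFunOn ℚ (line (Ioo 0 1)) (fun x : Fin 1 → ℝ => quart (x 0)) := by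
  have h := isSemialgebraicFunOn_mellinIntegrand
    (isSemialgebraic_line_Ioo isAlgebraic_zero isAlgebraic_one)
    ![(1 - X 0 ^ 4 : MvPolynomial (Fin 1) ℚ)] ![((5:ℚ) / 4 - 1 : ℚ)] 1 (fun x hx k => by
      have hx : x 0 ∈ Ioo (0:ℝ) 1 := hx
      simpa using one_sub_pow_four_pos hx)
  refine h.congr fun x hx => ?_
  simp only [mellinIntegrand_apply, Fin.prod_univ_one, Matrix.cons_val_fin_one, map_sub, map_one,
    map_pow, MvPolynomial.aeval_X, quart]
  push_cast
  ring_nf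

/-- **`R₄¹ = [(0,1), (1-x⁴)^{1/4}]`.** -/
def quart1 : IntegralRep 1 :=
  lineRep (Ioo 0 1) quart (isSemialgebraic_line_Ioo isAlgebraic_zero isAlgebraic_one)
    isSemialgebraicFunOn_quart integrableOn_quart

/-- The pull-back identity for `R₄`: `(1-x⁴)^{1/4} = ¼ (x⁴)^{-3/4}(1-x⁴)^{1/4} · |4x³|`. -/
theorem quart_pullback {x : ℝ} (hx : x ∈ Ioo (0:ℝ) 1) :
    quart x = (((1:ℚ) / 4 : ℚ) : ℝ) * ((x ^ 4) ^ ((((1:ℚ) / 4 : ℚ) : ℝ) - 1) *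
        (1 - x ^ 4) ^ ((((5:ℚ) / 4 : ℚ) : ℝ) - 1)) * |4 * x ^ 3| := by
  have h0 := hx.1
  rw [quart, pow_four_rpow_quarter_sub_one h0, abs_of_pos (by positivity)]
  push_cast
  field_simp

/-- **Move (`t = x⁴`): `R₄¹ ≡ ¼ · β(¼, 5/4)`.** -/
theorem quart1_sub_beta :
    of quart1 - of ((betaRep (1 / 4) (5 / 4) (by norm_num) (by norm_num)).constMul
      (((1:ℚ) / 4 : ℚ) : ℝ) (isAlgebraic_rat ℚ _)) ∈ relations := by
  rw [betaRep_constMul_eq_lineRep]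
  unfold quart1
  exact lineRep_subst (fun x => x ^ 4) (fun x => 4 * x ^ 3) isSemialgebraicFunOn_pow_four
    (fun t _ => hasDerivWithinAt_pow_four _ t) injOn_pow_four image_pow_four
    (fun x hx => quart_pullback hx)

/-- `β(¼, 5/4) = ½ β(¼,¼)` (translation). -/
theorem betaQ_quarter_fiveQuarters :
    betaQ (1 / 4) (5 / 4) = (((1:ℚ) / 2 : ℚ) : K₀) • betaQ (1 / 4) (1 / 4) := by
  have h := betaQ_transl (a := 1 / 4) (b := 1 / 4) (by norm_num) (by norm_num)
  rw [show ((1:ℚ) / 4 + 1 / 4 : ℚ) = 1 / 2 by norm_num,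
    show ((1:ℚ) / 4 + 1 : ℚ) = 5 / 4 by norm_num] at h
  have h2 := congrArg (fun q : Q => ((2:ℚ) : K₀) • q) h
  simp only [smul_smul] at h2
  rw [show (((2:ℚ) : K₀) * (((1:ℚ) / 2 : ℚ) : K₀)) = 1 by
      rw [← Rat.cast_mul]; norm_num, one_smul] at h2
  rw [h2, ← Rat.cast_mul]
  norm_num

/-- `[R₄¹] = ⅛ β(¼,¼)` in `Q`. -/
theorem mkQ_quart1 : mkQ (of quart1) = (((1:ℚ) / 8 : ℚ) : K₀) • betaQ (1 / 4) (1 / 4) := by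
  have h : mkQ (of quart1) = (((1:ℚ) / 4 : ℚ) : K₀) • betaQ (1 / 4) (5 / 4) := by
    rw [betaQ_eq (by norm_num) (by norm_num), ← mkQ_constMul_ratCast, mkQ_eq_mkQ_iff]
    exact quart1_sub_beta
  rw [h, betaQ_quarter_fiveQuarters, smul_smul, ← Rat.cast_mul]
  norm_num

/-! ## The elliptic curve `y² = 1 - x³`: `√(1-x³)` on the line -/

/-- The integrand `(1-x³)^{1/2}` of `R₃` on the line. -/
def ecub (x : ℝ) : ℝ := (1 - x ^ 3) ^ ((((3:ℚ) / 2 : ℚ) : ℝ) - 1)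

/-- `ecub x = √(1-x³)`. -/
theorem ecub_eq_sqrt (x : ℝ) : ecub x = Real.sqrt (1 - x ^ 3) :=
  rpow_threeHalves_sub_one_eq_sqrt _

/-- `ecub ≥ 0`. -/
theorem ecub_nonneg (x : ℝ) : 0 ≤ ecub x := by
  rw [ecub_eq_sqrt]
  exact Real.sqrt_nonneg _

/-- `ecub` is continuous. -/
theorem continuous_ecub : Continuous ecub :=
  (by fun_prop : Continuous fun x : ℝ => 1 - x ^ 3).rpow_const fun _ =>
    Or.inr (by rw [threeHalves_sub_one]; norm_num)

/-- `ecub` is integrable on `(0,1)`. -/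
theorem integrableOn_ecub : IntegrableOn ecub (Ioo 0 1) :=
  (continuous_ecub.continuousOn.integrableOn_Icc (μ := volume)).mono_set Ioo_subset_Icc_self

/-- `ecub` is `ℚ`-semialgebraic on `(0,1)`. -/
theorem isSemialgebraicFunOn_ecub :
    IsSemialgebraicFunOn ℚ (line (Ioo 0 1)) (fun x : Fin 1 → ℝ => ecub (x 0)) := by
  have h := isSemialgebraicFunOn_mellinIntegrand
    (isSemialgebraic_line_Ioo isAlgebraic_zero isAlgebraic_one)
    ![(1 - X 0 ^ 3 : MvPolynomial (Fin 1) ℚ)] ![((3:ℚ) / 2 - 1 : ℚ)] 1 (fun x hx k => by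
      have hx : x 0 ∈ Ioo (0:ℝ) 1 := hx
      simpa using one_sub_pow_three_pos hx)
  refine h.congr fun x hx => ?_
  simp only [mellinIntegrand_apply, Fin.prod_univ_one, Matrix.cons_val_fin_one, map_sub, map_one,
    map_pow, MvPolynomial.aeval_X, ecub]
  push_cast
  ring_nf

/-- **`R₃¹ = [(0,1), √(1-x³)]`.** -/
def ecub1 : IntegralRep 1 :=
  lineRep (Ioo 0 1) ecub (isSemialgebraic_line_Ioo isAlgebraic_zero isAlgebraic_one)
    isSemialgebraicFunOn_ecub integrableOn_ecub

/-- The pull-back identity for `R₃`: `√(1-x³) = ⅓ (x³)^{-2/3}(1-x³)^{1/2} · |3x²|`. -/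
theorem ecub_pullback {x : ℝ} (hx : x ∈ Ioo (0:ℝ) 1) :
    ecub x = (((1:ℚ) / 3 : ℚ) : ℝ) * ((x ^ 3) ^ ((((1:ℚ) / 3 : ℚ) : ℝ) - 1) *
        (1 - x ^ 3) ^ ((((3:ℚ) / 2 : ℚ) : ℝ) - 1)) * |3 * x ^ 2| := by
  have h0 := hx.1
  rw [ecub, pow_three_rpow_third_sub_one h0, abs_of_pos (by positivity)]
  push_cast
  field_simp

/-- **Move (`t = x³`): `R₃¹ ≡ ⅓ · β(⅓, 3/2)`.** -/
theorem ecub1_sub_beta :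
    of ecub1 - of ((betaRep (1 / 3) (3 / 2) (by norm_num) (by norm_num)).constMul
      (((1:ℚ) / 3 : ℚ) : ℝ) (isAlgebraic_rat ℚ _)) ∈ relations := by
  rw [betaRep_constMul_eq_lineRep]
  unfold ecub1
  exact lineRep_subst (fun x => x ^ 3) (fun x => 3 * x ^ 2) isSemialgebraicFunOn_pow_three
    (fun t _ => hasDerivWithinAt_pow_three _ t) injOn_pow_three image_pow_three
    (fun x hx => ecub_pullback hx)

/-- `β(⅓, 3/2) = (3/5) β(⅓,½)` (translation). -/
theorem betaQ_third_threeHalves :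
    betaQ (1 / 3) (3 / 2) = (((3:ℚ) / 5 : ℚ) : K₀) • betaQ (1 / 3) (1 / 2) := by
  have h := betaQ_transl (a := 1 / 3) (b := 1 / 2) (by norm_num) (by norm_num)
  rw [show ((1:ℚ) / 3 + 1 / 2 : ℚ) = 5 / 6 by norm_num,
    show ((1:ℚ) / 2 + 1 : ℚ) = 3 / 2 by norm_num] at h
  have h2 := congrArg (fun q : Q => (((6:ℚ) / 5 : ℚ) : K₀) • q) h
  simp only [smul_smul] at h2
  rw [show ((((6:ℚ) / 5 : ℚ) : K₀) * (((5:ℚ) / 6 : ℚ) : K₀)) = 1 by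
      rw [← Rat.cast_mul]; norm_num, one_smul] at h2
  rw [h2, ← Rat.cast_mul]
  norm_num

/-- `[R₃¹] = (1/5) β(⅓,½)` in `Q`. -/
theorem mkQ_ecub1 : mkQ (of ecub1) = (((1:ℚ) / 5 : ℚ) : K₀) • betaQ (1 / 3) (1 / 2) := by
  have h : mkQ (of ecub1) = (((1:ℚ) / 3 : ℚ) : K₀) • betaQ (1 / 3) (3 / 2) := by
    rw [betaQ_eq (by norm_num) (by norm_num), ← mkQ_constMul_ratCast, mkQ_eq_mkQ_iff]
    exact ecub1_sub_beta
  rw [h, betaQ_third_threeHalves, smul_smul, ← Rat.cast_mul]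
  norm_num

/-! ## The two rational planar regions -/

/-- The Fermat quartic quadrant `R₄ = {0<x<1, 0≤y, x⁴+y⁴ ≤ 1}`. -/
def kzQuart : Set (Fin 2 → ℝ) :=
  {z | (0 < z 0 ∧ z 0 < 1) ∧ 0 ≤ z 1 ∧ z 0 ^ 4 + z 1 ^ 4 ≤ 1}

/-- The region under `y² = 1 - x³`: `R₃ = {0<x<1, 0≤y, y² ≤ 1-x³}`. -/
def kzEcub : Set (Fin 2 → ℝ) :=
  {z | (0 < z 0 ∧ z 0 < 1) ∧ 0 ≤ z 1 ∧ z 1 ^ 2 ≤ 1 - z 0 ^ 3}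

/-- Membership in `kzQuart`, unfolded. -/
theorem mem_kzQuart {z : Fin 2 → ℝ} :
    z ∈ kzQuart ↔ (0 < z 0 ∧ z 0 < 1) ∧ 0 ≤ z 1 ∧ z 0 ^ 4 + z 1 ^ 4 ≤ 1 := Iff.rfl

/-- Membership in `kzEcub`, unfolded. -/
theorem mem_kzEcub {z : Fin 2 → ℝ} :
    z ∈ kzEcub ↔ (0 < z 0 ∧ z 0 < 1) ∧ 0 ≤ z 1 ∧ z 1 ^ 2 ≤ 1 - z 0 ^ 3 := Iff.rfl

/-- `kzQuart` is `ℚ`-semialgebraic. -/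
theorem isSemialgebraic_kzQuart : IsSemialgebraic ℚ kzQuart := by
  convert isSemialgebraic_subgraph (X 0 ^ 4 + X 1 ^ 4) 1 using 1
  ext z
  simp [kzQuart]

/-- `kzEcub` is `ℚ`-semialgebraic. -/
theorem isSemialgebraic_kzEcub : IsSemialgebraic ℚ kzEcub := by
  convert isSemialgebraic_subgraph (X 1 ^ 2) (1 - X 0 ^ 3) using 1
  ext z
  simp [kzEcub]

/-- `kzQuart` is the region under the graph of `quart`. -/
theorem kzQuart_eq : kzQuart = {z | (0 < z 0 ∧ z 0 < 1) ∧ 0 ≤ z 1 ∧ z 1 ≤ quart (z 0)} := by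
  ext z
  simp only [mem_kzQuart, mem_setOf_eq]
  refine and_congr_right fun hx => and_congr_right fun hy => ?_
  have hw := one_sub_pow_four_pos hx
  rw [← pow_le_pow_iff_left₀ hy (quart_nonneg hx) (by norm_num : (4:ℕ) ≠ 0), quart,
    rpow_quarter_pow_four hw.le]
  constructor <;> intro h <;> linarith

/-- `kzEcub` is the region under the graph of `ecub`. -/
theorem kzEcub_eq : kzEcub = {z | (0 < z 0 ∧ z 0 < 1) ∧ 0 ≤ z 1 ∧ z 1 ≤ ecub (z 0)} := by
  ext z
  simp only [mem_kzEcub, mem_setOf_eq]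
  refine and_congr_right fun hx => and_congr_right fun hy => ?_
  rw [ecub_eq_sqrt, Real.le_sqrt hy (one_sub_pow_three_pos hx).le]

/-- `kzQuart` lies in the unit square. -/
theorem kzQuart_subset : kzQuart ⊆ Icc 0 1 := subset_Icc_of_le_one fun z hz => by
  obtain ⟨hx, hy, h⟩ := hz
  refine ⟨hx, hy, ?_⟩
  have h4 : z 1 ^ 4 ≤ 1 := by nlinarith [pow_pos hx.1 4]
  exact (pow_le_one_iff_of_nonneg hy four_ne_zero).mp h4

/-- `kzEcub` lies in the unit square. -/
theorem kzEcub_subset : kzEcub ⊆ Icc 0 1 := subset_Icc_of_le_one fun z hz => by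
  obtain ⟨hx, hy, h⟩ := hz
  refine ⟨hx, hy, ?_⟩
  have h2 : z 1 ^ 2 ≤ 1 := by nlinarith [pow_pos hx.1 3]
  exact (pow_le_one_iff_of_nonneg hy two_ne_zero).mp h2

/-- **`R₄ = [{0<x<1, 0≤y, x⁴+y⁴≤1}, 1]`**, with `ℚ`-rational data. -/
def quart2 : IntegralRep 2 :=
  ratRep kzQuart (fun _ => 1) 1 1 isSemialgebraic_kzQuart (fun _ _ => by simp)
    (fun _ _ => by simp) (integrableOn_one_of_subset_Icc kzQuart_subset)

/-- **`R₃ = [{0<x<1, 0≤y, y²≤1-x³}, 1]`**, with `ℚ`-rational data. -/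
def ecub2 : IntegralRep 2 :=
  ratRep kzEcub (fun _ => 1) 1 1 isSemialgebraic_kzEcub (fun _ _ => by simp)
    (fun _ _ => by simp) (integrableOn_one_of_subset_Icc kzEcub_subset)

/-- `R₄` has KZ's literal rational shape. -/
theorem isRational_quart2 : quart2.IsRational := isRational_ratRep

/-- `R₃` has KZ's literal rational shape. -/
theorem isRational_ecub2 : ecub2.IsRational := isRational_ratRep

/-- **Move (Newton–Leibniz): `R₄ ≡ R₄¹`.** -/
theorem quart2_sub_quart1 : of quart2 - of quart1 ∈ relations :=
  subgraph_sub_lineRep quart2 (fun _ hx => quart_nonneg hx) kzQuart_eq rfl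

/-- **Move (Newton–Leibniz): `R₃ ≡ R₃¹`.** -/
theorem ecub2_sub_ecub1 : of ecub2 - of ecub1 ∈ relations :=
  subgraph_sub_lineRep ecub2 (fun _ _ => ecub_nonneg _) kzEcub_eq rfl

/-- **`[R₄] = ⅛•β(¼,¼)`** in `Q` (Newton–Leibniz, `t = x⁴`, translation). -/
theorem mkQ_quart2 : mkQ (of quart2) = (((1:ℚ) / 8 : ℚ) : K₀) • betaQ (1 / 4) (1 / 4) := by
  rw [← mkQ_quart1, mkQ_eq_mkQ_iff]
  exact quart2_sub_quart1

/-- **`[R₄] = (⅛·duplCoeff ¼)•β(¼,½)`**, `duplCoeff ¼ = √2` (plus Legendre duplication). -/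
theorem mkQ_quart2' : mkQ (of quart2) =
    ((((1:ℚ) / 8 : ℚ) : K₀) * duplCoeff (1 / 4)) • betaQ (1 / 4) (1 / 2) := by
  rw [mkQ_quart2, betaQ_dupl_quarter, smul_smul]

/-- **`[R₃] = (1/5)•β(⅓,½)`** in `Q` (Newton–Leibniz, `t = x³`, translation). -/
theorem mkQ_ecub2 : mkQ (of ecub2) = (((1:ℚ) / 5 : ℚ) : K₀) • betaQ (1 / 3) (1 / 2) := by
  rw [← mkQ_ecub1, mkQ_eq_mkQ_iff]
  exact ecub2_sub_ecub1

/-- **`[R₃] = ((1/5)(duplCoeff ⅓)⁻¹)•β(⅓,⅓)`**, `duplCoeff ⅓ = 2^{1/3}` (plus duplication). -/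
theorem mkQ_ecub2' : mkQ (of ecub2) =
    ((((1:ℚ) / 5 : ℚ) : K₀) * (duplCoeff (1 / 3))⁻¹) • betaQ (1 / 3) (1 / 3) := by
  rw [mkQ_ecub2, betaQ_dupl_third, smul_smul, mul_assoc,
    inv_mul_cancel₀ (duplCoeff_ne_zero _), mul_one]

/-- The area of the Fermat quartic quadrant: `∫∫_{R₄} 1 = Γ(¼)Γ(¼)/(8Γ(½))`. -/
theorem quart2_value :
    quart2.value = Real.Gamma (1 / 4) * Real.Gamma (1 / 4) / (8 * Real.Gamma (1 / 2)) := by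
  have h := congrArg evalQ mkQ_quart2
  rw [evalQ_mkQ, eval_of, evalQ_smul, evalQ_betaQ (by norm_num) (by norm_num),
    coe_ratCast_K₀] at h
  rw [h]
  push_cast
  norm_num
  ring

/-- The area under `y = √(1-x³)` on `(0,1)`: `∫∫_{R₃} 1 = Γ(⅓)Γ(½)/(5Γ(5/6))`. -/
theorem ecub2_value :
    ecub2.value = Real.Gamma (1 / 3) * Real.Gamma (1 / 2) / (5 * Real.Gamma (5 / 6)) := by
  have h := congrArg evalQ mkQ_ecub2
  rw [evalQ_mkQ, eval_of, evalQ_smul, evalQ_betaQ (by norm_num) (by norm_num),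
    coe_ratCast_K₀] at h
  rw [h]
  push_cast
  norm_num
  ring

end SoloBlind

end Summit.KontsevichZagierPeriods.KontsevichZagierPeriods.Theorems
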